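import Literature.MathematicalPhysics.QuantumFieldTheory.Balaban1983to89.B9Eq365QGGQLowerVariational
import Literature.MathematicalPhysics.QuantumFieldTheory.Balaban1983to89.B5Eq155FlatAveragingCommute
import Literature.MathematicalPhysics.QuantumFieldTheory.Balaban1983to89.B5QGGQ145Bounds

/-!
# `Balaban1983to89.B9Eq365QGGQFlatCarrierDictionary` — T. Bałaban, *Propagators and renormalization transformations for lattice gauge theories. I*,
# Commun. Math. Phys. **95** (1984) 17–40 [Balaban1984PropagatorsI] p. 25 («Δ′_a = Δ + aQ′_k^*Q′_k … its inverse is a bounded operator G′_k») with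
# T. Bałaban, *Propagators for lattice gauge theories in a background field*, Commun. Math. Phys. **99** (1985) 389–434 [Balaban1985BackgroundPropagators]
# (3.19) p. 393, (3.23)–(3.25) p. 394: **THE CARRIER DICTIONARY (J-M-α), PART 1 — the lit-balaban b04∕b05 cell's periodic functions on `ℤ^{d+1}`
# (`B4Green244.opD = −Δ^ξ + aQ^*Q`, `blockAvg`, `finePt`∕`coarse`, `B4TorusPositivity.box`∕`IsPeriodic`) AGAINST the pub-balaban NE9 chain's weighted `L²`
# carriers (`SiteL2K`, `QprimeW … 1`, `laplacePrimeA … 1 a′`) AT THE FLAT BACKGROUND: `Δ′_{a′}(1)` read componentwise on `ℤ^{d+1}` IS `(ηL)⁻²·opD L a 0`,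
# `a = a′(ηL)²c₁∕(c₀L^{d+1})`, and `Q̃′(1)† = (c₁∕(c₀L^{d+1}))·`(block-constant extension)**

statement-level skeleton of published theorems with citation tags; proofs where landed; nothing here is a claim about the Yang–Mills mass gap

CITATION HEADER (lean-in-tree rule).  Audit cell `pub-balaban`, sub-cell `t4`, BINDER row NE9; filed by NE9 formalisation-swarm LEAF PROVER 01
(`b2b-balaban-t4-ne9-formalise-leaf-01`, gen 81) as part 1 of the junction **(J-M-α)** of `t4/ROUTES-NE9.md` v13.31 ADDENDUM (iv) (crux-ideation lens 1,
t4-ne9-idea-1 gen 94: «WHAT IS GENUINELY MISSING = ONE JUNCTION, not a Fourier analysis: THE CARRIER DICTIONARY b05 ↔ the NE9 chain at `U = 1`»; first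
refusal named to this lineage as the author of `B9Eq365QGGQLowerVariational.qggq_coercive_flat`, whose crude variational constant the junction replaces by
the cell's exact (1.45) multiplier window — part 2 = `B9Eq365QGGQFlatSymbolTransfer`).  Sources READ in the held text layers: [B5′] = [Balaban1984PropagatorsI]
p. 25–26 (through the cell's audited headers `B5QGGQ145Torus` ∕ `B5QGGQ145Bounds`, renders `1984-cmp95-propagators-rt-I-p009∕p010`), [B9] =
[Balaban1985BackgroundPropagators] pp. 393–394, 416 (`paper:balaban1985-cmp99-background-propagators`, journal page = PDF page + 388); the lattice∕block loci
[B7] = [Balaban1985Averaging] (1)–(2) p. 17 («y_μ ≦ x_μ < y_μ + L») and [B4] = [Balaban1983RegularityDecay] (1.4)–(1.6) p. 572 (blocks, the torus «with periodic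
conditions») as quoted in the tree's `B9Eq319QprimeTorus` ∕ `B4Green244` ∕ `B4TorusPositivity` headers (the §1–§2 tags cite the objects being identified).

THE PRINT (verbatim).  [B5′] p. 25: *«with a > 0 (we will take eventually a = 1), and let us denote Δ′_a = Δ + aQ′_k^*Q′_k = Δ + aP′_k. The properties of
this operator were investigated in [2], its inverse is a bounded operator G′_k»*; p. 25: *«It is a translation invariant operator on the unit lattice
T₁^{(k)} and its Fourier transform can be written using formula (2.48) from [2].»*  [B9] p. 394 (3.25): *«Rf = (I − G′Q′*(Q′G′²Q′*)⁻¹Q′G′)f, where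
G′ = G′(U) = (Δ′_a)⁻¹»*; p. 416: *«Theorem 3.11. Under the assumptions of the Theorems 3.1–3.10 (i.e. for M sufficiently large and α₀ sufficiently small) the
operators Δ′_a, G′, (Q′G′²Q′*)⁻¹, Δ_a, G are positive definite.»*  The two cells type THE SAME flat operator `Δ′_a(1)` in two languages; this file is the
dictionary between them (bookkeeping only; nothing of [B5′]∕[B9] is asserted).

WHAT IS PROVED (sorry-free; 0 `def`; axioms standard; [folklore] lattice bookkeeping).  Throughout `m : Fin (d+1) → ℕ` is the coarse torus (b04 writes the
dimension as `d+1`), `L` the block size, `fineP L m = L·m` the fine torus, `perSite P : ℤ^{d+1} → TSite (d+1) P` the periodic reading (`B9Eq315QTorus`),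
`liftSite` its section (`B9Eq315QTorusOnto`; = b05's `B5QGGQ145Bounds.toZ`, `toZ_eq_liftSite`).
* §1 SITES: `perSite_translate` ∕ `isPeriodic_comp_perSite` (a torus function read on `ℤ^{d+1}` is `B4TorusPositivity.IsPeriodic`), `perSite_add_e` ∕
  `perSite_sub_e` (b04's `± e_μ` ARE the chain's `shift`∕`unshift`), `sum_box_eq_sum_liftSite` (sums over b04's period `box` = sums over `TSite`),
  `liftSite_perSite_of_mem`.
* §2 BLOCKS: `finePt_add_periodVec`, `perSite_eq_perSite_finePt` (every fine point reads as `L·liftSite(perSite m ⌊z∕L⌋) + (z mod L)`),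
  **`blockCoord_perSite`** (`blk (perSite (L·m) z) = perSite m ⌊z∕L⌋` — b04's `coarse` IS the chain's `blockCoord`), **`sum_blockOf_perSite`** (the chain's
  block sum `Σ_{x∈B(y)}` IS b04's offset sum `Σ_{j∈[0,L)^{d+1}}` over `finePt`), `coarse_mem_box`.
* §3 OPERATORS AT `U = 1`, COMPONENTWISE (`F_w(z) := ⟪w, u(perSite z)⟫` for a fibre vector `w ∈ W`): `equiv_covLaplace_one` (`Δ^η_1 = η⁻²·`second-difference
  stencil, `adTransportW_one`), **`inner_covLaplace_one_perSite`** (`⟪w, (Δ^η_1u)(perSite z)⟫ = η⁻²L⁻²·negLap L F_w z`), `QprimeW_one_eq_blockMean` (the flat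
  `Q′` is the plain block mean, [B7] p. 27, under `[Ring 𝔸]`), **`inner_QprimeW_one_perSite`** (`⟪w, (Q′(1)u)(perSite m ⌊z∕L⌋)⟫ = blockAvg L F_w z`),
  **`adjoint_QprimeWL2_one`** ∕ `equiv_adjoint_QprimeWL2_one` (`Q̃′(1)† = (c₁∕(c₀L^{d+1}))·(ψ ∘ blk)` between the `c₀`- and `c₁`-weighted carriers — at the
  canonical weights `c₀L^{d+1} = c₁` b05's `Q′^*`, `Q′Q′^* = 1`), **`inner_laplacePrimeA_one_perSite`** (`η ≠ 0`:
  `⟪w, (Δ′_{a′}(1)u)(perSite z)⟫ = (ηL)⁻²·opD L (a′(ηL)²c₁∕(c₀L^{d+1})) 0 F_w z` — on the diagonal `ηL = 1`, `c₀L^{d+1} = c₁` literally b04's `opD L a′ 0`).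
DICTIONARY ∕ HONEST SCOPE.  ξ-units of b04 (`ξ = L⁻¹`, `−Δ^ξ = L²·`stencil) against the chain's `η⁻¹`-scaled differences: the two agree up to the factor
`(ηL)⁻²` and the penalty weight rescales by `c₁∕(c₀L^{d+1})` — both `= 1` on the diagonal the NE9 chain uses ((3.35) p. 396, `T4CurrencyMatching`); flat
background ONLY (`U = 1`: every operator is `scalar ⊗ 1_W`, whence the componentwise reading); `m² = 0`.  NOT here: the Green's functions and the form
inequality (part 2), anything at `U ≠ 1`, any estimate.  Cell pub-balaban: NE9 NOT PRINTED ∕ NOT PROVED («NE9 ⇐ the named binders»); row WALLED ON A MODEL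
(O-NE9-1; #5 UNRULED); spine PROVED 0∕9; rung (B)+1 on a finite T⁴ — NOT infinite volume, NOT mass gap, NOT Clay; HONEST DEPENDENCY: continuum YM on T⁴ ⇐
BetaPertH ∧ nine spine estimates (0/9 proved); BetaPertH ⇐ (D1) ∧ (D4) ∧ CAP+tail; G-an2-4 gates asym, D1 and NE2/3/4.  NEW file importing
`B9Eq365QGGQLowerVariational` (this lineage), `B5Eq155FlatAveragingCommute` (this lineage: `shift_perSite`, `sum_blockOf_eq_sum_boxVec`) and the cell's
`B5QGGQ145Bounds` (lit-balaban b05: `toZ`, `sum_box_eq_sum_idx`); nothing modified.  Net new unproved facts: 0.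
-/

noncomputable section

open scoped BigOperators InnerProductSpace ComplexConjugate

namespace Literature.MathematicalPhysics.QuantumFieldTheory.Balaban1983to89.B9Eq365QGGQFlatCarrierDictionary

open B4Sect5Torus (TSite)
open B9SectCLatticeCarrier (Bond shift unshift shift_unshift unshift_shift bpos btgt)
open B9Eq311L2Pairing (WL2)
open B9Eq319QprimeTorus (fineP blockCoord mem_blockOf_iff Qprime_flat QprimeLin_apply)
open B11Eq103H1Complex (SiteL2K greenK apply_greenK covDerivL2K covDivL2K covLaplaceSiteK equiv_covDerivL2K equiv_covDivL2K)
open B9Eq33CovDerivVector (covDeriv_apply covDiv_apply)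
open B9Eq310HessianOperator (adTransportW)
open B5Eq172HodgePositivity (adTransportW_one adTransportW_inv_one hRS_one)
open B9Eq326OperatorAssembly (QprimeW)
open B9Eq3119DeltaPiCarrier (laplacePrimeA GpOfU)
open B9Eq325ProjFormula (laplacePrimeA_isSymmetric)
open B9Eq365QGGQLowerVariational (inner_qggq_eq_norm_sq)
open B9Eq315QTorus (perSite)
open B9Eq315QTorusOnto (liftSite periodVec perSite_add_periodVec perSite_liftSite liftSite_perSite_add)
open B5Eq155FlatAveragingCommute (shift_perSite sum_blockOf_eq_sum_boxVec perSite_cornerSite_add_boxVec_mem)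
open B4Green244 (coarse finePt negLap blockAvg opD finePt_coarse_offset coarse_finePt)
open B4TorusPositivity (box mem_box IsPeriodic wrap wrap_mem_box wrap_eq_self_of_mem period_pos torusGreen_existsUnique)
open B5QGGQ145Torus (GQ GQ_isPeriodic opD_GQ gram_qggq qggq)
open B5QGGQ145Bounds (ev dft form_qggq_re plancherel_box_real ev_window sum_box_eq_sum_idx toZ)

variable {d : ℕ}

/-! ## §1 The site dictionary `ℤ^{d+1} → T` (`perSite` = reduction mod the periods) against b04's `translate`/`e_μ`/`finePt`/`coarse` -/

section Sites

variable (P : Fin (d + 1) → ℕ) [∀ i, NeZero (P i)]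

/-- every period is `≥ 1` (the tori are non-degenerate). [cite: Balaban1985Averaging, (1) p.17; Balaban1983RegularityDecay, (1.6) p.572] -/
theorem one_le_period (i : Fin (d + 1)) : 1 ≤ P i := Nat.one_le_iff_ne_zero.mpr (NeZero.ne (P i))

omit [∀ i, NeZero (P i)] in
/-- b04's period translate IS the chain's `· + periodVec` (one torus, two spellings). [cite: Balaban1985Averaging, (1) p.17; Balaban1983RegularityDecay, (1.6) p.572] -/
theorem translate_eq_add_periodVec (z t : Fin (d + 1) → ℤ) : B4TorusKernel.MultiPeriod.translate P z t = z + periodVec P t := rfl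

/-- **the periodic reading forgets the periods**: `perSite P (z + P·t) = perSite P z`. [cite: Balaban1985Averaging, (1) p.17; Balaban1983RegularityDecay, (1.6) p.572] -/
theorem perSite_translate (z t : Fin (d + 1) → ℤ) : perSite P (B4TorusKernel.MultiPeriod.translate P z t) = perSite P z := by
  rw [translate_eq_add_periodVec, perSite_add_periodVec]

/-- **a torus function read on `ℤ^{d+1}` is periodic** (b04's `IsPeriodic`: «the torus T_η with periodic conditions»). [cite: Balaban1985Averaging, (1) p.17; Balaban1983RegularityDecay, (1.6) p.572] -/
theorem isPeriodic_comp_perSite (g : TSite (d + 1) P → ℂ) : IsPeriodic P (fun z => g (perSite P z)) := fun z t => by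
  show g (perSite P (B4TorusKernel.MultiPeriod.translate P z t)) = g (perSite P z)
  rw [perSite_translate]

/-- b04's unit vector `e_μ` IS [B7]'s `e_μ` (both `Pi.single μ 1`). [cite: Balaban1985Averaging, (1) p.17] -/
theorem e_eq (μ : Fin (d + 1)) : B4Green244.e μ = B7Prop1Explicit.e μ := rfl

/-- **the forward step**: `perSite P (z + e_μ) = shift μ (perSite P z)` (this lineage's `shift_perSite`). [cite: Balaban1985Averaging, (1) p.17] -/
theorem perSite_add_e (z : Fin (d + 1) → ℤ) (μ : Fin (d + 1)) : perSite P (z + B4Green244.e μ) = shift μ (perSite P z) := by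
  rw [e_eq, shift_perSite]

/-- **the backward step**: `perSite P (z − e_μ) = unshift μ (perSite P z)`. [cite: Balaban1985Averaging, (1) p.17] -/
theorem perSite_sub_e (z : Fin (d + 1) → ℤ) (μ : Fin (d + 1)) : perSite P (z - B4Green244.e μ) = unshift μ (perSite P z) := by
  have h : shift μ (perSite P (z - B4Green244.e μ)) = perSite P z := by rw [← perSite_add_e, sub_add_cancel]
  rw [← h, unshift_shift]

omit [∀ i, NeZero (P i)] in
/-- b05's representative `toZ` IS the chain's `liftSite`. [cite: Balaban1985Averaging, (1) p.17; Balaban1983RegularityDecay, (1.6) p.572] -/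
theorem toZ_eq_liftSite (x : TSite (d + 1) P) : toZ x = liftSite x := rfl

omit [∀ i, NeZero (P i)] in
/-- **sums over b04's period box are sums over the torus sites** (`B5QGGQ145Bounds.sum_box_eq_sum_idx`). [cite: Balaban1985Averaging, (1) p.17; Balaban1983RegularityDecay, (1.6) p.572] -/
theorem sum_box_eq_sum_liftSite {M : Type*} [AddCommMonoid M] (F : (Fin (d + 1) → ℤ) → M) :
    ∑ z ∈ box P, F z = ∑ x : TSite (d + 1) P, F (liftSite x) :=
  sum_box_eq_sum_idx P F

omit [∀ i, NeZero (P i)] in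
/-- representatives lie in the period box. [cite: Balaban1985Averaging, (1) p.17; Balaban1983RegularityDecay, (1.6) p.572] -/
theorem liftSite_mem_box (x : TSite (d + 1) P) : liftSite x ∈ box P := B5QGGQ145Bounds.toZ_mem_box x

/-- on the period box the reading is inverted by `liftSite`. [cite: Balaban1985Averaging, (1) p.17; Balaban1983RegularityDecay, (1.6) p.572] -/
theorem liftSite_perSite_of_mem {z : Fin (d + 1) → ℤ} (hz : z ∈ box P) : liftSite (perSite P z) = z := by
  funext i
  have h := (mem_box.mp hz) i
  simp only [liftSite, perSite, Int.emod_eq_of_lt h.1 h.2, Int.toNat_of_nonneg h.1]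

end Sites

/-! ## §2 Blocks: b04's `finePt`/`coarse` against the chain's `blockOf`/`blockCoord` under the periodic reading -/

section Blocks

variable (L : ℕ) [NeZero L] (m : Fin (d + 1) → ℕ) [∀ i, NeZero (m i)] [∀ i, NeZero (fineP L m i)]

omit [NeZero L] [∀ i, NeZero (m i)] [∀ i, NeZero (fineP L m i)] in
/-- `L·(x + m·t) + j = (L·x + j) + (L·m)·t` (b04's fine point `finePt` of a translated coarse point). [cite: Balaban1985Averaging, (2) p.17; Balaban1983RegularityDecay, (1.4)–(1.5) p.572] -/
theorem finePt_add_periodVec (x t : Fin (d + 1) → ℤ) (j : Fin (d + 1) → Fin L) :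
    finePt L (x + periodVec m t) j = finePt L x j + periodVec (fineP L m) t := by
  funext i
  simp only [finePt, periodVec, fineP, Pi.add_apply, Nat.cast_mul]
  ring

omit [NeZero L] in
/-- the fine reading of `L·x + j` only depends on the coarse reading of `x`. [cite: Balaban1985Averaging, (2) p.17; Balaban1983RegularityDecay, (1.4)–(1.5) p.572] -/
theorem perSite_finePt_liftSite_perSite (x : Fin (d + 1) → ℤ) (j : Fin (d + 1) → Fin L) :
    perSite (fineP L m) (finePt L (liftSite (perSite m x)) j) = perSite (fineP L m) (finePt L x j) := by
  conv_rhs => rw [← liftSite_perSite_add m x, finePt_add_periodVec, perSite_add_periodVec]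

/-- **every fine point reads as a point of the block over the reading of its coarse point**:
`perSite (L·m) z = perSite (L·m) (L·liftSite (perSite m ⌊z∕L⌋) + (z mod L))`. [cite: Balaban1985Averaging, (2) p.17; Balaban1983RegularityDecay, (1.4)–(1.5) p.572] -/
theorem perSite_eq_perSite_finePt (z : Fin (d + 1) → ℤ) :
    perSite (fineP L m) z = perSite (fineP L m) (finePt L (liftSite (perSite m (coarse L z))) (B4Green244.offset L z)) := by
  rw [perSite_finePt_liftSite_perSite, finePt_coarse_offset]

omit [NeZero L] [∀ i, NeZero (m i)] [∀ i, NeZero (fineP L m i)] in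
/-- b04's `finePt L (liftSite y) r` IS the chain's `cornerSite L y + boxVec L r` («y_μ ≦ x_μ < y_μ + L»). [cite: Balaban1985Averaging, (2) p.17; Balaban1983RegularityDecay, (1.4)–(1.5) p.572] -/
theorem finePt_liftSite_eq (y : TSite (d + 1) m) (r : Fin (d + 1) → Fin L) :
    finePt L (liftSite y) r = B9Eq315QTorus.cornerSite L y + B7Prop1Explicit.boxVec L r := rfl

/-- **THE BLOCK COORDINATE OF A READ FINE POINT IS THE READING OF b04's COARSE POINT**: `blk (perSite (L·m) z) = perSite m ⌊z∕L⌋` (b04's `coarse` IS the chain's `blockCoord`). [cite: Balaban1985Averaging, (2) p.17; Balaban1983RegularityDecay, (1.4)–(1.5) p.572] -/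
theorem blockCoord_perSite (z : Fin (d + 1) → ℤ) : blockCoord L m (perSite (fineP L m) z) = perSite m (coarse L z) := by
  have h := perSite_cornerSite_add_boxVec_mem L m (perSite m (coarse L z)) (B4Green244.offset L z)
  rw [mem_blockOf_iff, ← finePt_liftSite_eq, ← perSite_eq_perSite_finePt] at h
  exact h

/-- **BLOCK SUMS ARE b04's OFFSET SUMS**: `Σ_{x ∈ B(perSite m x₀)} G x = Σ_{j ∈ [0,L)^{d+1}} G (perSite (L·m) (L·x₀ + j))` (the block `B(y)` has the `L^{d+1}` points `L·y + j`). [cite: Balaban1985Averaging, (2) p.17; Balaban1983RegularityDecay, (1.4)–(1.5) p.572] -/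
theorem sum_blockOf_perSite {M : Type*} [AddCommMonoid M] (G : TSite (d + 1) (fineP L m) → M) (x₀ : Fin (d + 1) → ℤ) :
    ∑ x ∈ B9Eq319QprimeTorus.blockOf L m (perSite m x₀), G x = ∑ j : Fin (d + 1) → Fin L, G (perSite (fineP L m) (finePt L x₀ j)) := by
  rw [sum_blockOf_eq_sum_boxVec]
  exact Finset.sum_congr rfl fun j _ => by rw [← finePt_liftSite_eq, perSite_finePt_liftSite_perSite]

omit [∀ i, NeZero (m i)] [∀ i, NeZero (fineP L m i)] in
/-- a point of the fine period box has its b04 coarse point in the coarse period box. [cite: Balaban1985Averaging, (2) p.17; Balaban1983RegularityDecay, (1.4)–(1.5) p.572] -/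
theorem coarse_mem_box {z : Fin (d + 1) → ℤ} (hz : z ∈ box (fineP L m)) : coarse L z ∈ box m := by
  rw [mem_box] at hz ⊢
  intro i
  have hL : (0 : ℤ) < L := by exact_mod_cast Nat.pos_of_ne_zero (NeZero.ne L)
  obtain ⟨h0, h1⟩ := hz i
  refine ⟨Int.ediv_nonneg h0 hL.le, ?_⟩
  simp only [coarse]
  rw [Int.ediv_lt_iff_lt_mul hL]
  simpa [fineP, Nat.cast_mul, mul_comm] using h1

end Blocks

/-! ## §3 The chain's operators at the flat background, read componentwise on `ℤ^{d+1}`: `Δ^η_1 ↔ (ηL)⁻²·(−Δ^ξ)`, `Q′(1) ↔` block mean,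
`Q̃′(1)† ↔ (c₁∕(c₀L^{d+1}))·`(block-constant extension), `Δ′_{a′}(1) ↔ (ηL)⁻²·opD L (a′(ηL)²c₁∕(c₀L^{d+1})) 0` -/

/-- the `RCLike` coercion `ℝ → ℂ` of the generic weighted-`L²` lemmas IS the `Complex` coercion (cast normalisation; private helper). [folklore] -/
private theorem rclike_ofReal_eq_coe (r : ℝ) : (@RCLike.ofReal ℂ _ r) = (r : ℂ) := rfl

section Operators

variable (L : ℕ) [NeZero L] (m : Fin (d + 1) → ℕ) [∀ i, NeZero (m i)] [∀ i, NeZero (fineP L m i)]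
  {𝔸 : Type*} [Ring 𝔸] [Algebra ℂ 𝔸] {W : Type*} [NormedAddCommGroup W] [InnerProductSpace ℂ W]
  (φ : W ≃ₗ[ℂ] 𝔸) (c₀ : ℝ) [Fact (0 < c₀)] (η : ℝ) (c₁ : ℝ) [Fact (0 < c₁)]

omit [NeZero L] [∀ i, NeZero (m i)] [∀ i, NeZero (fineP L m i)] in
/-- **THE FLAT COVARIANT LAPLACIAN IS THE SECOND-DIFFERENCE STENCIL**: at `U = 1` (both transporters the identity, `adTransportW_one`),
`(D*_1D_1u)(x) = η⁻²·Σ_μ (2u(x) − u(x+e_μ) − u(x−e_μ))` ((3.3) with `c = η⁻¹`, (3.8), (3.23)). [cite: Balaban1985BackgroundPropagators, (3.23) p.394, (3.3) p.391, (3.8) p.392] -/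
theorem equiv_covLaplace_one (u : SiteL2K ℂ (d + 1) (fineP L m) c₀ W) (x : TSite (d + 1) (fineP L m)) :
    WL2.equiv ℂ _ W (covLaplaceSiteK ((η : ℂ))⁻¹ (adTransportW φ (fun _ : Bond (d + 1) (fineP L m) => (1 : 𝔸ˣ)))
        (adTransportW φ fun _ : Bond (d + 1) (fineP L m) => (1 : 𝔸ˣ)⁻¹) u) x =
      ((η : ℂ))⁻¹ ^ 2 • ∑ μ, ((2 : ℂ) • WL2.equiv ℂ _ W u x - WL2.equiv ℂ _ W u (shift μ x) - WL2.equiv ℂ _ W u (unshift μ x)) := by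
  rw [covLaplaceSiteK, LinearMap.comp_apply, equiv_covDivL2K, covDiv_apply, equiv_covDerivL2K]
  simp only [covDeriv_apply, bpos, btgt, adTransportW_one, adTransportW_inv_one, LinearMap.id_apply, shift_unshift]
  rw [pow_two, mul_smul, Finset.smul_sum, Finset.smul_sum, Finset.smul_sum]
  exact Finset.sum_congr rfl fun μ _ => by module

omit [∀ i, NeZero (m i)] in
/-- **… READ ON `ℤ^{d+1}`, COMPONENT BY COMPONENT: `⟪w, (Δ^η_1u)(z mod L·m)⟫ = η⁻²L⁻²·(−Δ^ξ)_L F_w(z)`** with `F_w(z) = ⟪w, u(z mod L·m)⟫` and b04's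
`negLap L` (`= L²·Σ_μ(2F − F(·+e_μ) − F(·−e_μ))`, ξ-units `ξ = L⁻¹`). [cite: Balaban1985BackgroundPropagators, (3.23) p.394; Balaban1983RegularityDecay, (2.44) p.584] -/
theorem inner_covLaplace_one_perSite (u : SiteL2K ℂ (d + 1) (fineP L m) c₀ W) (w : W) (z : Fin (d + 1) → ℤ) :
    ⟪w, WL2.equiv ℂ _ W (covLaplaceSiteK ((η : ℂ))⁻¹ (adTransportW φ (fun _ : Bond (d + 1) (fineP L m) => (1 : 𝔸ˣ)))
        (adTransportW φ fun _ : Bond (d + 1) (fineP L m) => (1 : 𝔸ˣ)⁻¹) u) (perSite (fineP L m) z)⟫_ℂ =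
      ((η : ℂ))⁻¹ ^ 2 * ((L : ℂ) ^ 2)⁻¹ * negLap L (fun z' => ⟪w, WL2.equiv ℂ _ W u (perSite (fineP L m) z')⟫_ℂ) z := by
  have hL : (L : ℂ) ≠ 0 := by exact_mod_cast NeZero.ne L
  rw [equiv_covLaplace_one, inner_smul_right, negLap]
  simp only [perSite_add_e, perSite_sub_e, inner_sum, inner_sub_right, inner_smul_right]
  field_simp

omit [∀ i, NeZero (m i)] [∀ i, NeZero (fineP L m i)] [Fact (0 < c₀)] in
/-- **`Q′(1)` IS THE PLAIN BLOCK MEAN** `(Q′(1)u)(y) = Σ_{x∈B(y)} L^{−(d+1)} u(x)` ([B7] p. 27), for the chain's `QprimeW` under `[Ring 𝔸]` (re-derived as in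
`B9Eq319BlockTentLift.QprimeW_one_lift`; the `NormedRing` twin is `B5Eq155FlatAveragingCommute.QprimeW_one_apply`). [cite: Balaban1985BackgroundPropagators, (3.19) p.393; Balaban1985Averaging, p.27] -/
theorem QprimeW_one_eq_blockMean (u : SiteL2K ℂ (d + 1) (fineP L m) c₀ W) (y : TSite (d + 1) m) :
    QprimeW L m φ (fun _ : Bond (d + 1) (fineP L m) => (1 : 𝔸ˣ)) (c₀ := c₀) u y =
      ∑ x ∈ B9Eq319QprimeTorus.blockOf L m y, ((L : ℝ) ^ (d + 1))⁻¹ • WL2.equiv ℂ _ W u x := by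
  rw [QprimeW, LinearMap.comp_apply, LinearEquiv.coe_toLinearMap, WL2.linearEquiv_apply, QprimeLin_apply]
  have hflat : (fun bd : Bond (d + 1) (fineP L m) => (adTransportW φ (fun _ : Bond (d + 1) (fineP L m) => (1 : 𝔸ˣ)) bd).restrictScalars ℝ) =
      fun _ => LinearMap.id := by
    funext bd; rw [adTransportW_one, LinearMap.restrictScalars_id]
  rw [hflat, Qprime_flat]

omit [Fact (0 < c₀)] in
/-- **… READ ON `ℤ^{d+1}`: `⟪w, (Q′(1)u)(⌊z∕L⌋ mod m)⟫ = (Q^*QF_w)(z)`** — b04's `blockAvg L F_w z = L^{−(d+1)}Σ_{j} F_w(L⌊z∕L⌋ + j)`.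
[cite: Balaban1985BackgroundPropagators, (3.19) p.393; Balaban1983RegularityDecay, (1.4)–(1.5) p.572] -/
theorem inner_QprimeW_one_perSite (u : SiteL2K ℂ (d + 1) (fineP L m) c₀ W) (w : W) (z : Fin (d + 1) → ℤ) :
    ⟪w, QprimeW L m φ (fun _ : Bond (d + 1) (fineP L m) => (1 : 𝔸ˣ)) (c₀ := c₀) u (perSite m (coarse L z))⟫_ℂ =
      blockAvg L (fun z' => ⟪w, WL2.equiv ℂ _ W u (perSite (fineP L m) z')⟫_ℂ) z := by
  rw [QprimeW_one_eq_blockMean, sum_blockOf_perSite, blockAvg, inner_sum, Finset.mul_sum]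
  refine Finset.sum_congr rfl fun j _ => ?_
  rw [RCLike.real_smul_eq_coe_smul (K := ℂ), inner_smul_right]
  push_cast
  ring

variable [FiniteDimensional ℂ W]

omit [∀ i, NeZero (m i)] [∀ i, NeZero (fineP L m i)] in
/-- **THE ADJOINT OF THE FLAT `Q̃′(1)` BETWEEN THE WEIGHTED CARRIERS IS `(c₁∕(c₀L^{d+1}))·`(BLOCK-CONSTANT EXTENSION)**:
`Q̃′(1)†ψ = (c₁∕(c₀L^{d+1}))·(ψ ∘ blk)` (`Σ_y c₁⟨L^{−(d+1)}Σ_{x∈B(y)}u(x), ψ(y)⟩ = Σ_x c₀⟨u(x), (c₁∕(c₀L^{d+1}))ψ(blk x)⟩`; at the canonical weights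
`c₀L^{d+1} = c₁` this is b05's `Q′^*` = block-constant extension, `Q′Q′^* = 1`). [cite: Balaban1985BackgroundPropagators, (3.19) p.393, (3.24) p.394, (3.11) p.392; Balaban1984PropagatorsI, p.25] -/
theorem adjoint_QprimeWL2_one :
    LinearMap.adjoint ((WL2.linearEquiv ℂ ℂ (fun _ : TSite (d + 1) m => c₁)).symm.toLinearMap ∘ₗ
        QprimeW L m φ (fun _ : Bond (d + 1) (fineP L m) => (1 : 𝔸ˣ)) (c₀ := c₀)) =
      (((c₁ / (c₀ * (L : ℝ) ^ (d + 1)) : ℝ) : ℂ)) •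
        ((WL2.linearEquiv ℂ ℂ (fun _ : TSite (d + 1) (fineP L m) => c₀)).symm.toLinearMap ∘ₗ
          LinearMap.funLeft ℂ W (blockCoord L m) ∘ₗ (WL2.linearEquiv ℂ ℂ (fun _ : TSite (d + 1) m => c₁)).toLinearMap) := by
  have hc₀ : (c₀ : ℂ) ≠ 0 := by exact_mod_cast (Fact.out : 0 < c₀).ne'
  have hL : (L : ℂ) ≠ 0 := by exact_mod_cast NeZero.ne L
  refine B9Eq311L2Pairing.adjoint_eq_of_sum_inner _ _ fun f g => ?_
  simp only [rclike_ofReal_eq_coe, LinearMap.comp_apply, LinearEquiv.coe_toLinearMap, WL2.linearEquiv_symm_apply, WL2.linearEquiv_apply,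
    Equiv.apply_symm_apply, QprimeW_one_eq_blockMean, sum_inner, Finset.mul_sum, inner_smul_left_eq_smul, Complex.real_smul,
    LinearMap.smul_apply, WL2.equiv_smul, Pi.smul_apply, inner_smul_right, LinearMap.funLeft_apply]
  rw [← B9Eq319QprimeLipschitz.sum_blockOf_sum (L := L) (m := m)]
  refine Finset.sum_congr rfl fun y _ => Finset.sum_congr rfl fun x hx => ?_
  rw [(mem_blockOf_iff L m y x).1 hx]
  push_cast
  field_simp

omit [∀ i, NeZero (m i)] [∀ i, NeZero (fineP L m i)] in
/-- pointwise: `(Q̃′(1)†ψ)(x) = (c₁∕(c₀L^{d+1}))·ψ(blk x)`. [cite: Balaban1985BackgroundPropagators, (3.19) p.393, (3.24) p.394] -/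
theorem equiv_adjoint_QprimeWL2_one (ψ : SiteL2K ℂ (d + 1) m c₁ W) (x : TSite (d + 1) (fineP L m)) :
    WL2.equiv ℂ _ W (LinearMap.adjoint ((WL2.linearEquiv ℂ ℂ (fun _ : TSite (d + 1) m => c₁)).symm.toLinearMap ∘ₗ
        QprimeW L m φ (fun _ : Bond (d + 1) (fineP L m) => (1 : 𝔸ˣ)) (c₀ := c₀)) ψ) x =
      (((c₁ / (c₀ * (L : ℝ) ^ (d + 1)) : ℝ) : ℂ)) • WL2.equiv ℂ _ W ψ (blockCoord L m x) := by
  rw [adjoint_QprimeWL2_one, LinearMap.smul_apply, WL2.equiv_smul, Pi.smul_apply]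
  rfl

/-- **`Δ′_{a′}(1)` READ ON `ℤ^{d+1}` IS `(ηL)⁻²` TIMES b04's OPERATOR `D = −Δ^ξ + a·Q^*Q` AT `a = a′(ηL)²c₁∕(c₀L^{d+1})`**:
`⟪w, (Δ′_{a′}(1)u)(z mod L·m)⟫ = (ηL)⁻²·(opD L (a′(ηL)²c₁∕(c₀L^{d+1})) 0 F_w)(z)` (`η ≠ 0`; on the diagonal `ηL = 1`, `c₀L^{d+1} = c₁` this is
`opD L a′ 0` itself — b05's `Δ′_a = Δ + aQ′^*Q′` of [B5] p. 25). [cite: Balaban1985BackgroundPropagators, (3.24) p.394; Balaban1984PropagatorsI, p.25; Balaban1983RegularityDecay, (2.44) p.584] -/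
theorem inner_laplacePrimeA_one_perSite (hη : η ≠ 0) (a' : ℝ) (u : SiteL2K ℂ (d + 1) (fineP L m) c₀ W) (w : W) (z : Fin (d + 1) → ℤ) :
    ⟪w, WL2.equiv ℂ _ W (laplacePrimeA L m φ η (fun _ : Bond (d + 1) (fineP L m) => (1 : 𝔸ˣ)) a' (c₀ := c₀) (c₁ := c₁) u)
        (perSite (fineP L m) z)⟫_ℂ =
      ((((η * L) ^ 2)⁻¹ : ℝ) : ℂ) *
        opD L (a' * (η * L) ^ 2 * (c₁ / (c₀ * (L : ℝ) ^ (d + 1)))) 0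
          (fun z' => ⟪w, WL2.equiv ℂ _ W u (perSite (fineP L m) z')⟫_ℂ) z := by
  have hL : (L : ℂ) ≠ 0 := by exact_mod_cast NeZero.ne L
  have hη' : (η : ℂ) ≠ 0 := by exact_mod_cast hη
  rw [laplacePrimeA, LinearMap.add_apply, WL2.equiv_add, Pi.add_apply, inner_add_right, inner_covLaplace_one_perSite,
    LinearMap.smul_apply, WL2.equiv_smul, Pi.smul_apply, inner_smul_right, LinearMap.comp_apply, equiv_adjoint_QprimeWL2_one,
    inner_smul_right, blockCoord_perSite, LinearMap.comp_apply, LinearEquiv.coe_toLinearMap, WL2.linearEquiv_symm_apply,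
    Equiv.apply_symm_apply, inner_QprimeW_one_perSite, opD]
  push_cast
  field_simp
  ring

end Operators

end Literature.MathematicalPhysics.QuantumFieldTheory.Balaban1983to89.B9Eq365QGGQFlatCarrierDictionary

end
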